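import Literature.AlgebraicGeometry.Frobenioids.ArithmeticFrobenioidThm64ivCompat
import HarnessLib

/-!
# Frobenioids I, Thm. 6.4 (iv) at the constructions: the compatibility clause from «`Ψ^Base` acts on
# `Aut_{D₁}(X)` as conjugation by a field isomorphism» — the field-theoretic endgame

Mochizuki, *The geometry of Frobenioids I: the general theory*, Kyushu J. Math. **62** (2008) 293–400, §6,
Thm. 6.4 (iv) p. 115 l. 17–29 ("the corresponding finite extension `L₂` of `F₂` is isomorphic to `L₁` in a fashion
that is compatible with an isomorphism `F₁ ⥲ F₂`") [cite: MochizukiFrdI2008, Thm. 6.4 (iv) p.115].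

PROOF-ONLY file (cell abc-iut, GAP-LEDGER row G-L1t3-1 #2; seat abc-iut-w4-d090; the endgame of
abc-iut-L1-d3's archimedean-rigidity programme for the non-Galois clause).  Setting: the base part
`Ψ^Base : D₁ ⥤ D₂` (an equivalence) of an equivalence of arithmetic Frobenioids, an object `X = Spec L₁` of `D₁`
with `L₁` Galois over `ℚ`, a field isomorphism `e : L₁ ≅ L₂ := (Ψ^Base X).L` (the tree's `Thm64iv_arith_fieldIso`)
and an automorphism `s` of `L₁` (the archimedean-rigidity output) such that `Ψ^Base` IS CONJUGATION BY `e ∘ s` on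
`Aut_{D₁}(X) = Gal(L₁/F₁)`:  `Ψ^Base(h) (e x) = e (s (h (s⁻¹ x)))`.  Then:
* `nonempty_baseRingEquiv_of_conj` — `F₁ ≅ F₂`: `e ∘ s` carries `F₁ = Fix(Gal(L₁/F₁))` onto
  `Fix(Gal(L₂/F₂)) = F₂` (both extensions Galois as tops of Galois extensions of `ℚ`; every element of
  `Gal(L₂/F₂)` is a `Ψ^Base(h)`, `Ψ^Base` being full);
* `Thm64iv_arith_compat_of_conj` — hence THE CLAUSE at `X` (abc-iut-L1-d4's `Thm64iv_compat_of_fieldIso_of_baseIso`).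
No definitions, no named facts; nothing here bears on [IUTchIII] Cor. 3.12 or asserts anything about abc.
-/

noncomputable section

namespace Literature.AlgebraicGeometry.Frobenioids

open CategoryTheory NumberField

section Arith

variable {F₁ : Type} [Field F₁] [NumberField F₁] {K₁ : Type} [Field K₁] [Algebra F₁ K₁]
variable {F₂ : Type} [Field F₂] [NumberField F₂] {K₂ : Type} [Field K₂] [Algebra F₂ K₂]

/-- **`F₁ ≅ F₂` from the conjugation identity.**  If `Ψ^Base : D₁ ⥤ D₂` is an equivalence, `X.L` is Galois over
`ℚ`, `e : X.L ≅ (Ψ^Base X).L` is a field isomorphism and `s` an automorphism of `X.L` with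
`Ψ^Base(h) ∘ e = e ∘ s ∘ h ∘ s⁻¹` for every `h ∈ Aut_{D₁}(X)`, then `F₁ ≅ F₂`: the isomorphism `e ∘ s` maps the
image of `F₁` (the fixed field of `Aut_{D₁}(X) = Gal(X.L/F₁)`) onto the image of `F₂` (the fixed field of
`Gal(L₂/F₂)`, each element of which is a `Ψ^Base(h)`). [cite: MochizukiFrdI2008, Thm. 6.4 (iv) p.115] -/
theorem nonempty_baseRingEquiv_of_conj (ΨBase : FinSubextCat F₁ K₁ ⥤ FinSubextCat F₂ K₂) [ΨBase.IsEquivalence]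
    (X : FinSubextCat F₁ K₁) (hX : IsGalois ℚ X.L) (e : X.L ≃+* (ΨBase.obj X).L) (s : X.L ≃+* X.L)
    (hconj : ∀ (h : X ≅ X) (x : X.L),
      (ΨBase.map h.hom).toAlgHom (e x) = e (s (h.hom.toAlgHom (s.symm x)))) :
    Nonempty (F₁ ≃+* F₂) := by
  classical
  haveI := hX
  haveI : IsGalois F₁ X.L := IsGalois.tower_top_of_isGalois ℚ F₁ X.L
  let eQ : X.L ≃ₐ[ℚ] (ΨBase.obj X).L :=
    AlgEquiv.ofRingEquiv (f := e) fun q => (e : X.L →+* (ΨBase.obj X).L).map_rat_algebraMap q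
  haveI : IsGalois ℚ (ΨBase.obj X).L := IsGalois.of_algEquiv eQ
  haveI : IsGalois F₂ (ΨBase.obj X).L := IsGalois.tower_top_of_isGalois ℚ F₂ (ΨBase.obj X).L
  -- (1) `e (s a)` is fixed by `Gal(L₂/F₂)` for `a ∈ F₁`
  have hfix : ∀ (a : F₁) (τ₀ : (ΨBase.obj X).L ≃ₐ[F₂] (ΨBase.obj X).L),
      τ₀ (e (s (algebraMap F₁ X.L a))) = e (s (algebraMap F₁ X.L a)) := by
    intro a τ₀
    let τ : ΨBase.obj X ≅ ΨBase.obj X :=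
      { hom := ⟨(τ₀ : (ΨBase.obj X).L →ₐ[F₂] (ΨBase.obj X).L)⟩
        inv := ⟨(τ₀.symm : (ΨBase.obj X).L →ₐ[F₂] (ΨBase.obj X).L)⟩
        hom_inv_id := FinSubextCat.hom_ext (AlgHom.ext fun x => τ₀.apply_symm_apply x)
        inv_hom_id := FinSubextCat.hom_ext (AlgHom.ext fun x => τ₀.symm_apply_apply x) }
    have hmap : ΨBase.map (ΨBase.preimageIso τ).hom = τ.hom := by
      rw [Functor.preimageIso_hom, Functor.map_preimage]
    have h1 := hconj (ΨBase.preimageIso τ) (s (algebraMap F₁ X.L a))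
    rw [hmap, RingEquiv.symm_apply_apply, AlgHom.commutes] at h1
    exact h1
  -- (2) hence `e (s a) = b ∈ F₂`
  have hrange : ∀ a : F₁, ∃ b : F₂,
      algebraMap F₂ (ΨBase.obj X).L b = e (s (algebraMap F₁ X.L a)) := fun a =>
    (IsGalois.mem_range_algebraMap_iff_fixed _).mpr (hfix a)
  choose e₀ he₀ using hrange
  -- (3) every `b ∈ F₂` is reached: `s⁻¹ (e⁻¹ b)` is fixed by `Gal(X.L/F₁) ⊆ Aut_{D₁}(X)`
  have hsurj : ∀ b : F₂, ∃ a : F₁, e₀ a = b := by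
    intro b
    have hy : ∀ g : X.L ≃ₐ[F₁] X.L, g (s.symm (e.symm (algebraMap F₂ (ΨBase.obj X).L b))) =
        s.symm (e.symm (algebraMap F₂ (ΨBase.obj X).L b)) := by
      intro g
      let h : X ≅ X :=
        { hom := ⟨(g : X.L →ₐ[F₁] X.L)⟩
          inv := ⟨(g.symm : X.L →ₐ[F₁] X.L)⟩
          hom_inv_id := FinSubextCat.hom_ext (AlgHom.ext fun x => g.apply_symm_apply x)
          inv_hom_id := FinSubextCat.hom_ext (AlgHom.ext fun x => g.symm_apply_apply x) }
      have h1 := hconj h (e.symm (algebraMap F₂ (ΨBase.obj X).L b))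
      rw [RingEquiv.apply_symm_apply, AlgHom.commutes] at h1
      have h2 := congrArg (fun z => s.symm (e.symm z)) h1
      simp only [RingEquiv.symm_apply_apply] at h2
      exact h2.symm
    obtain ⟨a, ha⟩ := (IsGalois.mem_range_algebraMap_iff_fixed _).mpr hy
    refine ⟨a, (algebraMap F₂ (ΨBase.obj X).L).injective ?_⟩
    rw [he₀, ha, RingEquiv.apply_symm_apply, RingEquiv.apply_symm_apply]
  -- (4) `e₀` is a ring isomorphism
  have hinj := (algebraMap F₂ (ΨBase.obj X).L).injective
  let φ : F₁ →+* F₂ :=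
    { toFun := e₀
      map_one' := hinj (by simp only [he₀, map_one])
      map_mul' := fun a b => hinj (by simp only [he₀, map_mul])
      map_zero' := hinj (by simp only [he₀, map_zero])
      map_add' := fun a b => hinj (by simp only [he₀, map_add]) }
  exact ⟨RingEquiv.ofBijective φ ⟨φ.injective, hsurj⟩⟩

/-- **[FrdI] Thm. 6.4 (iv), the compatibility clause at `X`, from the conjugation identity**: under the
hypotheses of `nonempty_baseRingEquiv_of_conj`, `L₂ := (Ψ^Base X).L` is isomorphic to `L₁ = X.L` compatibly
with an isomorphism `F₁ ≅ F₂` (abc-iut-L1-d4's `Thm64iv_compat_of_fieldIso_of_baseIso`: any field isomorphism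
`L₁ ≅ L₂` can be adjusted by `Gal(L₂/ℚ)` to extend a given `F₁ ≅ F₂`). [cite: MochizukiFrdI2008, Thm. 6.4 (iv) p.115] -/
theorem Thm64iv_arith_compat_of_conj (ΨBase : FinSubextCat F₁ K₁ ⥤ FinSubextCat F₂ K₂) [ΨBase.IsEquivalence]
    (X : FinSubextCat F₁ K₁) (hX : IsGalois ℚ X.L) (e : X.L ≃+* (ΨBase.obj X).L) (s : X.L ≃+* X.L)
    (hconj : ∀ (h : X ≅ X) (x : X.L),
      (ΨBase.map h.hom).toAlgHom (e x) = e (s (h.hom.toAlgHom (s.symm x)))) :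
    ∃ (e' : X.L ≃+* (ΨBase.obj X).L) (e₀ : F₁ ≃+* F₂),
      ∀ a : F₁, e' (algebraMap F₁ X.L a) = algebraMap F₂ (ΨBase.obj X).L (e₀ a) := by
  obtain ⟨φ⟩ := nonempty_baseRingEquiv_of_conj ΨBase X hX e s hconj
  exact Thm64iv_compat_of_fieldIso_of_baseIso ΨBase X hX e φ

end Arith

end Literature.AlgebraicGeometry.Frobenioids

end
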